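import Summits.BirchSwinnertonDyer.Rank2.ToyRankThreeOrderEqualityAtTwo
import Summits.BirchSwinnertonDyer.Rank2.Family81517MinimalOrdinary
import Literature.NumberTheory.EllipticCurves.KatoRankBound
import HarnessLib

/-!
# The toy `E₀ = [1, 4, 0, 105, 0]` is good ORDINARY at `2`; `corank = ord L₂ = 3` from NAMED facts
# (Kato 18.4 at all primes, Modularity) plus the one analytic certificate

Cell `bsd-rank2` (D-0036), seat `bsd-rank2-eng-2` GEN 4; companion of
`Rank2/ToyRankThreeOrderEqualityAtTwo.lean` (director-bsd ruling 2026-08-27T04:43:36Z (5); planner p2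
G14 memo `PADIC-R2-G14.md` §4.4). There, `toy_selmerCorank_eq_order_eq_three` takes Kato's inequality
for `E₀` and the existence of a newform as ad-hoc hypotheses. Here both are read off the tree's NAMED
Literature facts, so that the toy's trust base is exactly {Kato 2004 Thm. 18.4 at `p = 2`
(`kato_selmerCorank_le_order_padicLFunction_allPrimes`, taken for all curves), Modularity
(`exists_isNewformOf`), the finite `2`-adic certificate (hypothesis `hC`)}:

* `toy_integralModelInt`, `toy_minimalDiscriminantInt` (`Δ_min = −70901775`),
  `toy_hasGoodReductionAtPrime_two` (`Δ_min` odd), `toyInt_map_zmod_two` (`Ẽ₀/𝔽₂ : y² + xy = x³ + x`,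
  `#Ẽ₀(𝔽₂) = 4`, `a₂ = −1`), `toy_not_two_dvd_frobeniusTrace`, **`toy_isOrdinaryAt_two`**;
* **`toy_selmerCorank_eq_order_eq_three_of_facts`** — `corank_{ℤ₂} Sel_{2^∞}(E₀/ℚ) = 3` and
  `ord_{T=0} L₂(f, α₂; T) = 3` for every newform `f` of `E₀`, from the two named facts and `hC`.

THEOREMS ONLY (no definition, no named fact, no `sorry`). PARTITION: none — r_an ≥ 2, summit axis S0;
TWIN (D-0056): n/a. B1 honesty: single-curve corank/order statement conditional on two published
theorems (named facts, displayed) and one finite computation (displayed); nothing reads an analytic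
rank; no S0 motion.

References: K. Kato, *Astérisque* 295 (2004) Thm. 18.4 [Kato2004Asterisque]; C. Breuil, B. Conrad,
F. Diamond, R. Taylor, *J. AMS* 14 (2001) [BCDTJAMS2001]; J. H. Silverman, *AEC* (2009) VII.1, V.2
[SilvermanAEC2009].
-/

set_option linter.dupNamespace false

noncomputable section

open scoped Classical
open WeierstrassCurve Literature.NumberTheory.EllipticCurves
  Literature.NumberTheory.EllipticCurves.ModularForms

namespace Summit.BirchSwinnertonDyer.Rank2

/-! ### §1 The minimal model's integral data and good ordinary reduction at `2` -/

/-- The rational toy model is the base change of the integer model `[1, 4, 0, 105, 0]`. [folklore] -/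
theorem toyInt_baseChange :
    (⟨1, 4, 0, 105, 0⟩ : WeierstrassCurve ℤ).baseChange ℚ = ⟨1, 4, 0, 105, 0⟩ := by
  rw [baseChange_int_eq_map]; exact toyInt_map_eq

/-- The tree's integral model of the (globally minimal) toy model is `[1, 4, 0, 105, 0]` itself.
[cite: SilvermanAEC2009, VII Remark 1.1] -/
theorem toy_integralModelInt :
    @integralModelInt (⟨1, 4, 0, 105, 0⟩ : WeierstrassCurve ℚ) toy_isGloballyMinimal =
      ⟨1, 4, 0, 105, 0⟩ := by
  have key : ∀ (X : WeierstrassCurve ℚ) (hX : X.IsGloballyMinimal),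
      (⟨1, 4, 0, 105, 0⟩ : WeierstrassCurve ℤ).baseChange ℚ = X →
        @integralModelInt X hX = ⟨1, 4, 0, 105, 0⟩ := by
    rintro X hX rfl
    exact integralModelInt_baseChange_int _
  exact key _ _ toyInt_baseChange

/-- `Δ_min(E₀) = −70901775`. [cite: SilvermanAEC2009, VII Remark 1.1] -/
theorem toy_minimalDiscriminantInt :
    @minimalDiscriminantInt (⟨1, 4, 0, 105, 0⟩ : WeierstrassCurve ℚ) toy_isGloballyMinimal =
      -70901775 := by
  rw [minimalDiscriminantInt, toy_integralModelInt, toyInt_Δ]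

/-- **`E₀` has good reduction at `2`** (`Δ_min` is odd). [cite: SilvermanAEC2009, VII.5.1(a)] -/
theorem toy_hasGoodReductionAtPrime_two :
    (⟨1, 4, 0, 105, 0⟩ : WeierstrassCurve ℚ).HasGoodReductionAtPrime 2 := by
  haveI := toy_isGloballyMinimal
  refine hasGoodReductionAtPrime_of_not_dvd _ 2 ?_
  rw [toy_minimalDiscriminantInt]; norm_num

/-- The reduction of `[1, 4, 0, 105, 0]` modulo `2` is `y² + xy = x³ + x` (`⟨1, 0, 0, 1, 0⟩`). [folklore] -/
theorem toyInt_map_zmod_two :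
    (⟨1, 4, 0, 105, 0⟩ : WeierstrassCurve ℤ).map (Int.castRingHom (ZMod 2)) = ⟨1, 0, 0, 1, 0⟩ := by
  ext <;> simp [WeierstrassCurve.map] <;> decide

/-- **`a₂(E₀)` is odd** (`#Ẽ₀(𝔽₂) = 4`, `a₂ = 3 − 4 = −1`). [cite: SilvermanAEC2009, V.2 (trace of Frobenius)] -/
theorem toy_not_two_dvd_frobeniusTrace :
    ¬ ((2 : ℕ) : ℤ) ∣ @frobeniusTrace (⟨1, 4, 0, 105, 0⟩ : WeierstrassCurve ℚ) toy_isGloballyMinimal 2 := by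
  rw [frobeniusTrace, reductionPointCount, toy_integralModelInt, toyInt_map_zmod_two]
  rcases natCard_point_F2_family81517 (0 : ZMod 2) with h | h <;> rw [h] <;> norm_num

/-- **`E₀` is good ORDINARY at `2`**, for any global-minimality witness (the predicate is
proof-irrelevant in the instance). [cite: SilvermanAEC2009, V.2 and VII.5.1(a)] -/
theorem toy_isOrdinaryAt_two (hmin : (⟨1, 4, 0, 105, 0⟩ : WeierstrassCurve ℚ).IsGloballyMinimal) :
    @IsOrdinaryAt (⟨1, 4, 0, 105, 0⟩ : WeierstrassCurve ℚ) hmin 2 _ :=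
  ⟨toy_hasGoodReductionAtPrime_two, toy_not_two_dvd_frobeniusTrace⟩

/-! ### §2 `corank = ord = 3` from the named facts and the certificate -/

/-- **`corank_{ℤ₂} Sel_{2^∞}(E₀/ℚ) = ord_{T=0} L₂(E₀, T) = 3` for the rank-three curve `E₀`, from NAMED
facts.** Inputs: (1) Kato 2004 Thm. 18.4 at `p = 2`, as the tree's named fact
`kato_selmerCorank_le_order_padicLFunction_allPrimes` for every globally minimal elliptic curve and
newform (`hKato`); (2) Modularity, the tree's named fact `exists_isNewformOf` (`hmod`); (3) the finite
`2`-adic certificate for `E₀` (`hC`: an integral nonzero multiple of `L₂(f, α₂; T)` divisible by `T + 2`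
with a unit coefficient in degree `≤ 4`; numerically kit j265726, not certified in the tree). Everything
else — `E₀` elliptic, globally minimal, good ordinary at `2`, `rank E₀(ℚ) ≥ 3` — is PROVED
(`toy_isOrdinaryAt_two`, `toy_three_le_mordellWeilRank`). [cite: Kato2004Asterisque, Thm. 18.4 (p. 281)]
[cite: BCDTJAMS2001, Thm. A (modularity)] -/
theorem toy_selmerCorank_eq_order_eq_three_of_facts
    (hKato : ∀ (W : WeierstrassCurve ℚ) [W.IsElliptic] [W.IsGloballyMinimal] ⦃N : ℕ⦄ [NeZero N]
      (f : CuspForm (CongruenceSubgroup.Gamma0 N) 2),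
      kato_selmerCorank_le_order_padicLFunction_allPrimes W 2 (f := f))
    (hmod : exists_isNewformOf)
    (hC : ∀ (hmin : (⟨1, 4, 0, 105, 0⟩ : WeierstrassCurve ℚ).IsGloballyMinimal) ⦃N : ℕ⦄ [NeZero N]
      (f : CuspForm (CongruenceSubgroup.Gamma0 N) 2),
      IsNewformOf (⟨1, 4, 0, 105, 0⟩ : WeierstrassCurve ℚ) f →
        ∃ (c : ℚ_[2]) (g : PowerSeries ℤ_[2]), c ≠ 0 ∧
          g.map (PadicInt.Coe.ringHom (p := 2)) =
            PowerSeries.C c * padicLFunction f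
              (@unitRoot (⟨1, 4, 0, 105, 0⟩ : WeierstrassCurve ℚ) hmin 2 _ : ℚ_[2]) ∧
          (PowerSeries.X + PowerSeries.C (2 : ℤ_[2])) ∣ g ∧ ∃ i ≤ 4, IsUnit (PowerSeries.coeff i g)) :
    (⟨1, 4, 0, 105, 0⟩ : WeierstrassCurve ℚ).selmerCorank 2 = 3 ∧
      ∀ (hmin : (⟨1, 4, 0, 105, 0⟩ : WeierstrassCurve ℚ).IsGloballyMinimal) ⦃N : ℕ⦄ [NeZero N]
        (f : CuspForm (CongruenceSubgroup.Gamma0 N) 2),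
        IsNewformOf (⟨1, 4, 0, 105, 0⟩ : WeierstrassCurve ℚ) f →
          (padicLFunction f
            (@unitRoot (⟨1, 4, 0, 105, 0⟩ : WeierstrassCurve ℚ) hmin 2 _ : ℚ_[2])).order = 3 := by
  haveI := toy_isElliptic
  refine toy_selmerCorank_eq_order_eq_three (fun hmin N _ f hf ↦ ?_) hC ?_
  · exact @hKato _ _ hmin N _ f (toy_isOrdinaryAt_two hmin) hf
  · haveI : NeZero ((⟨1, 4, 0, 105, 0⟩ : WeierstrassCurve ℚ).conductorNorm ℤ) :=
      ⟨((⟨1, 4, 0, 105, 0⟩ : WeierstrassCurve ℚ).conductorNorm_pos_holds).ne'⟩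
    obtain ⟨f, hf⟩ := hmod (⟨1, 4, 0, 105, 0⟩ : WeierstrassCurve ℚ)
    exact ⟨_, inferInstance, f, hf⟩

end Summit.BirchSwinnertonDyer.Rank2

end
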